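import Summits.NavierStokesRegularity.NavierStokesRegularity.Theorems.AdaptedFrequencyFrequencyRigiditySmallScaledEnergyRegular
import Summits.NavierStokesRegularity.NavierStokesRegularity.Theorems.AdaptedFrequencyFrequencyRigidityFlatBackwardSingular
import HarnessLib

/-!
# Crux `FrequencyRigidity` (stmt-NavierStokesRegularity-2955), line `scaled-energy-split`:
# the small-scaled-energy gap of the finite child in Albritton–Barker form (Stub 2′)

Helper file (`--supports stmt-NavierStokesRegularity-2955`; theorems only, sorry-free).

Stub 2′ of the line (`stub_finiteScaledEnergyLiouvilleAB`) forbids an inhabitant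
`(C, Λ₀, v, q, K)` of the unit-viscosity crux body — a classical ancient Navier–Stokes flow
`(v, q)` on `ℝ³ × (−∞, 0)` with the global Type-I bound `‖v(t, x)‖ ≤ C/√(−t)`, an adapted
Gaussian-comparable kernel `K` at the pole, positive adapted enstrophy and constant adapted
frequency — lying in the Albritton–Barker class: SOME suitable pressure `ϖ`
(`IsSuitableWeakSolutionOn` on the open backward slab, Caffarelli–Kohn–Nirenberg 1982,
(2.1)–(2.5)) and weak spatial gradient `G'` with Albritton–Barker quantity
`𝐈 = 𝐈(ℝ³ × ℝ₋; v, ϖ, G')` (`typeIBound (Iio 0 ×ˢ univ) v ϖ G'`, the supremum of `A + C + D + E`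
over all backward parabolic balls of the lower half space).  This file closes its SMALL-`𝐈` case
(registered stubs `finiteAB_smallScaledEnergyRegular`, `finiteAB_smallScaledEnergyGap`), the
A–B-form twins of the classical-form theorems `stub_smallScaledEnergyRegular` /
`stub2_smallScaledEnergyGap` (pressure `q`, gradient `fderiv`; lead c7, wave 2).  In the A–B form
the statement is the natural one: Seregin's backward ε-regularity criterion is a theorem about
suitable weak solutions, so the classical ⇒ suitable packaging step of the classical form
disappears.

* `finiteAB_smallScaledEnergyRegular`: there is an absolute `ε > 0` such that a field `u` with a
  suitable pressure `ϖ` and a weak gradient `G` on the slab and `𝐈(u, ϖ, G) < ε` is not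
  backward-singular at the space–time origin.  Take `ε` from Seregin's criterion (Seregin 2014,
  Ch. 6, Thm. 1.4, tree theorem `seregin2014_thm14_holds`): a suitable weak solution in the unit
  parabolic ball `Q((0,0), 1)` (`IsSuitableWeakSolutionInBall 1 0`) with a weak gradient `G` and
  `sup_{0<r<1} E(r) < ε`, `E(r) = r⁻¹ ∫_{Q(r)} |G|²`, is essentially bounded on some `Q((0,0), ϱ)`,
  `0 < ϱ < 1`.  If the origin were backward-singular, `𝐈 < ε < ∞` and the slab packaging
  `isLocalTypeISingularPoint_of_slabProfile` put `(u, ϖ − [ϖ]_{B(0,1)})` in that class, with the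
  restricted weak gradient `G` and `sup_{0<r<1} E(r) ≤ 𝐈 < ε`
  (`smallEnergy_iSup_cknE_le_typeIBound`: `E ≤ A + C + D + E ≤ 𝐈`, and `E` does not see the
  pressure gauge) — so `u` is bounded on some `Q((0,0), ϱ)`, contradicting singularity.
* `finiteAB_smallScaledEnergyGap`: with the same `ε`, no unit-viscosity Stub-2′ witness has
  `𝐈(v, ϖ, G') < ε`: the pole of every witness of the crux body is backward-singular for `v`
  (`isBackwardSingularPoint_of_witness`, lead c6), which the core applied to `(v, ϖ, G')` forbids.

## References

* G. Seregin, *Lecture Notes on Regularity Theory for the Navier–Stokes Equations*, World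
  Scientific (2014), Ch. 6, §6.1, Thm. 1.4. [Seregin2014]
* D. Albritton, T. Barker, *On local Type I singularities of the Navier–Stokes equations and
  Liouville theorems*, J. Math. Fluid Mech. 21 (2019), §1 (the quantities `A, C, D, E, 𝐈(ω)`,
  backward singular points), Def. 2.1. [AlbrittonBarker2019]
* L. Caffarelli, R. Kohn, L. Nirenberg, *Partial regularity of suitable weak solutions of the
  Navier–Stokes equations*, Comm. Pure Appl. Math. 35 (1982), (2.1)–(2.5), Prop. 2.
  [CaffarelliKohnNirenberg1982]
-/

noncomputable section

-- the registered stub namespace repeats the summit name `NavierStokesRegularity` (summit = problem)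
set_option linter.dupNamespace false

namespace Summit.NavierStokesRegularity.NavierStokesRegularity.Theorems

open Literature.Analysis.FluidPDE MeasureTheory Set Filter Function
open Summit.NavierStokesRegularity.NavierStokesRegularity.Theorems.FrequencyRigidity.ScaledEnergySplit

/-- **Stub `finiteAB_smallScaledEnergyRegular` (small-scaled-energy core of Stub 2′, line
`scaled-energy-split`).**  There is an absolute `ε > 0` such that: if `(u, ϖ)` is a suitable weak
solution of the unforced unit-viscosity Navier–Stokes system on the open backward slab
`(−∞, 0) × ℝ³` with a weak spatial gradient `G` and Albritton–Barker quantity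
`𝐈(ℝ³ × ℝ₋; u, ϖ, G) < ε`, then the space–time origin is not a backward singular point of `u`.
Otherwise `(u, ϖ − [ϖ]_{B(0,1)})` is a suitable weak solution in the unit parabolic ball in
Albritton–Barker's class (`isLocalTypeISingularPoint_of_slabProfile`, using `𝐈 < ε < ∞`) with the
weak gradient `G` on `Q((0,0), 1)` and `sup_{0<r<1} E(r) ≤ 𝐈 < ε`
(`smallEnergy_iSup_cknE_le_typeIBound`), and Seregin's backward ε-regularity criterion
(`seregin2014_thm14_holds`) bounds `u` on some `Q((0,0), ϱ)`, contradicting singularity.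
[cite: Seregin2014, Ch. 6 §6.1 Theorem 1.4, PDF p. 94] -/
theorem finiteAB_smallScaledEnergyRegular : ∃ ε : ℝ, 0 < ε ∧ ∀ (u : ℝ → EuclideanSpace ℝ (Fin 3) → EuclideanSpace ℝ (Fin 3)) (ϖ : ℝ → EuclideanSpace ℝ (Fin 3) → ℝ) (G : ℝ → EuclideanSpace ℝ (Fin 3) → EuclideanSpace ℝ (Fin 3) →L[ℝ] EuclideanSpace ℝ (Fin 3)), Literature.Analysis.FluidPDE.IsSuitableWeakSolutionOn (Literature.Analysis.FluidPDE.slab (EuclideanSpace ℝ (Fin 3)) (Set.Iio 0) isOpen_Iio) 1 0 u ϖ → Literature.Analysis.FluidPDE.HasWeakSpatialGradientOn (Literature.Analysis.FluidPDE.slab (EuclideanSpace ℝ (Fin 3)) (Set.Iio 0) isOpen_Iio) u G → Literature.Analysis.FluidPDE.typeIBound (Set.Iio (0:ℝ) ×ˢ Set.univ) u ϖ G < ENNReal.ofReal ε → ¬ Literature.Analysis.FluidPDE.IsBackwardSingularPoint u 0 := by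
  obtain ⟨ε, hε, hS⟩ := seregin2014_thm14_holds
  refine ⟨ε, hε, fun u ϖ G hsw hwg hI hsing => ?_⟩
  -- `𝐈 < ε < ∞` and a singular origin: A–B's class in the unit ball, pressure gauged by its mean
  obtain ⟨-, hball, -, -⟩ :=
    isLocalTypeISingularPoint_of_slabProfile hsw hwg (hI.trans_le le_top) hsing
  -- the weak gradient `G` on the unit ball and the smallness of `sup_{0<r<1} E(r)`
  have hwgQ : HasWeakSpatialGradientOn
      (parabolicCylinderOpens 1 (0 : ℝ × EuclideanSpace ℝ (Fin 3))) u G :=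
    hwg.mono (parabolicCylinderOpens_le_slab 1 le_rfl)
  have hE : (⨆ r ∈ Ioo (0 : ℝ) 1, cknE r (0 : ℝ × EuclideanSpace ℝ (Fin 3)) G) <
      ENNReal.ofReal ε :=
    smallEnergy_iSup_cknE_le_typeIBound.trans_lt hI
  -- Seregin: `u` is bounded on some `Q((0,0), ϱ)`
  obtain ⟨ϱ, hϱ, hfin⟩ := hS u _ hball ⟨G, hwgQ, hE⟩
  exact hfin.ne (hsing ϱ hϱ.1)

/-- **Stub `finiteAB_smallScaledEnergyGap` (the small-scaled-energy gap of Stub 2′, line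
`scaled-energy-split`).**  With the absolute `ε > 0` of `finiteAB_smallScaledEnergyRegular`: no
inhabitant `(C, Λ₀, v, q, K)` of the unit-viscosity crux body (classical ancient flow with the
global Type-I bound, adapted Gaussian-comparable kernel at the pole, positive adapted enstrophy
and constant adapted frequency) admits a suitable pressure `ϖ` and a weak gradient `G'` on the
backward slab with `𝐈(ℝ³ × ℝ₋; v, ϖ, G') < ε`.  The pole of every witness is backward-singular
for `v` (`isBackwardSingularPoint_of_witness` at `ν = 1`), contradicting the core applied to
`(v, ϖ, G')`. [cite: Seregin2014, Ch. 6 §6.1 Theorem 1.4, PDF p. 94] -/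
theorem finiteAB_smallScaledEnergyGap : ∃ ε : ℝ, 0 < ε ∧ ∀ (C Λ₀ : ℝ) (v : ℝ → EuclideanSpace ℝ (Fin 3) → EuclideanSpace ℝ (Fin 3)) (q : ℝ → EuclideanSpace ℝ (Fin 3) → ℝ) (K : ℝ → EuclideanSpace ℝ (Fin 3) → ℝ), (Literature.Analysis.FluidPDE.IsClassicalNSSolutionOn (Set.Iio 0) 1 0 v q ∧ (∀ t ∈ Set.Iio (0:ℝ), ∀ x, ‖v t x‖ ≤ C / Real.sqrt (-t)) ∧ ContDiffOn ℝ 2 (Function.uncurry K) (Set.Iio (0:ℝ) ×ˢ Set.univ) ∧ (∀ t ∈ Set.Iio (0:ℝ), ∀ x, 0 < K t x) ∧ (∀ t ∈ Set.Iio (0:ℝ), ∀ x, Literature.Analysis.FluidPDE.timeDerivWithin (Set.Iio (0:ℝ)) K t x + fderiv ℝ (K t) x (v t x) + 1 * Laplacian.laplacian (K t) x = 0) ∧ (∀ t ∈ Set.Iio (0:ℝ), ∫ x, K t x = 1) ∧ (∀ φ : EuclideanSpace ℝ (Fin 3) → ℝ, Continuous φ → (∃ M : ℝ, ∀ x, |φ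 x| ≤ M) → Filter.Tendsto (fun t => ∫ x, φ x * K t x) (nhdsWithin (0:ℝ) (Set.Iio (0:ℝ))) (nhds (φ (0 : EuclideanSpace ℝ (Fin 3))))) ∧ (∃ c₁ c₂ C₁ C₂ : ℝ, 0 < c₁ ∧ 0 < c₂ ∧ 0 < C₁ ∧ 0 < C₂ ∧ ∀ t ∈ Set.Iio (0:ℝ), ∀ x, c₁ * ((0:ℝ) - t) ^ (-(3:ℝ) / 2) * Real.exp (-(‖x - (0 : EuclideanSpace ℝ (Fin 3))‖ ^ 2) / (c₂ * ((0:ℝ) - t))) ≤ K t x ∧ K t x ≤ C₁ * ((0:ℝ) - t) ^ (-(3:ℝ) / 2) * Real.exp (-(‖x - (0 : EuclideanSpace ℝ (Fin 3))‖ ^ 2) / (C₂ * ((0:ℝ) - t)))) ∧ (∀ H Λ : ℝ → ℝ, H = (fun t => ∫ x, ‖Literature.Analysis.FluidPDE.curl (v t) x‖ ^ 2 * K t x) → Λ = (fun t => (0 - t) * deriv H t / H t) → (∀ t ∈ Set.Iio (0:ℝ), 0 < H t) ∧ (∀ t ∈ Set.Iio (0:ℝ), Λ t = Λ₀))) → ∀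 (ϖ : ℝ → EuclideanSpace ℝ (Fin 3) → ℝ) (G' : ℝ → EuclideanSpace ℝ (Fin 3) → EuclideanSpace ℝ (Fin 3) →L[ℝ] EuclideanSpace ℝ (Fin 3)), Literature.Analysis.FluidPDE.IsSuitableWeakSolutionOn (Literature.Analysis.FluidPDE.slab (EuclideanSpace ℝ (Fin 3)) (Set.Iio 0) isOpen_Iio) 1 0 v ϖ → Literature.Analysis.FluidPDE.HasWeakSpatialGradientOn (Literature.Analysis.FluidPDE.slab (EuclideanSpace ℝ (Fin 3)) (Set.Iio 0) isOpen_Iio) v G' → Literature.Analysis.FluidPDE.typeIBound (Set.Iio (0:ℝ) ×ˢ Set.univ) v ϖ G' < ENNReal.ofReal ε → False := by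
  obtain ⟨ε, hε, hE⟩ := finiteAB_smallScaledEnergyRegular
  refine ⟨ε, hε, fun C Λ₀ v q K hb ϖ G' hsw hwg hI => ?_⟩
  obtain ⟨hNS, hTI, hK1, hK2, hK3, hK4, hK5, hCmp, hF⟩ := hb
  exact hE v ϖ G' hsw hwg hI
    (isBackwardSingularPoint_of_witness one_pos hNS hTI ⟨hK1, hK2, hK3, hK4, hK5⟩ hCmp hF)

end Summit.NavierStokesRegularity.NavierStokesRegularity.Theorems

end
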